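import Mathlib

/-!
# Crux-strategist s2 — typed first lemma of the crux idea `coulomb-phase-decoherence`
# (kernel of `WindowedShellChannels`, stmt-FinalStateConjecture-14085)

The radiation-side forms of the one-ended windowed channel energy of parity-pure data (lead c4, Lines/Sketch-c4.md §1b;
re-derived by this seat): for a real spectral density `c` and a real phase `θ`,
`Z(u) = ∫ c(ω) e^{i(θ(ω) − ωu)} dω`, `E = ∫ |Z|² = 2π ∫ c²`, `A(u₀) = ∫_{u<u₀} |Z|²`, `B(u₀) = Re ∫_{u<u₀} Z²`,
`caught_even = A − sB`, `caught_odd = A + sB` (`s = ±1`).  The kernel needs `A − |B| ≥ c₀ E` for all real `c`.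

`CoulombPhaseChannelLemma` below is the REPAIRED form of c4's lemma (F3): c4 asked only `ω θ'' ≥ a`; that version is
FALSE (this seat: a group-delay kink — a narrow burst of `ω θ''`, allowed by a one-sided bound — shifts the phase by a
bad constant `π/4` on an arbitrarily long low-frequency band where the `a`-curvature is negligible, and the
Côte–Kenig–Schlag / KLLS scale-spread family then drives one parity to `0`; kit j023605).  The Regge–Wheeler phase has
its log-curvature PINNED on both sides (`ω θ'' → 2M` at low frequency, the Coulomb logarithm of the tortoise
normalisation; `≤ A(ρ)` below the barrier-top band), so the honest lemma carries a two-sided bound `a/ω ≤ θ'' ≤ A/ω`.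
By scaling only `A/a` matters.  Pure harmonic analysis on the line — no GR vocabulary. [new; conjectural]
-/

noncomputable section

open MeasureTheory Set Filter
open scoped Topology

set_option linter.dupNamespace false

namespace Summit.FinalStateConjecture.FinalStateConjecture.Cruxes.WindowedShellChannels.CoulombPhase

/-- **(F3′) Coulomb-phase channel lemma** (typed first lemma of the crux idea `coulomb-phase-decoherence`).
For log-curvature pinned in `[a, A]` (`a/ω ≤ θ'' ≤ A/ω` on `(0, W)`), group delays before the window edge
(`θ' ≤ u₀`) and a benign zero-frequency phase (`θ(0⁺) ∈ (π/2)ℤ`), every real continuous compactly supported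
spectral density on `(0, W)` has `A(u₀) − |B(u₀)| ≥ c₀(a, A) · E`. [new; conjectural] -/
def CoulombPhaseChannelLemma : Prop :=
  ∀ a A : ℝ, 0 < a → a ≤ A → ∃ c₀ : ℝ, 0 < c₀ ∧ ∀ (W u₀ : ℝ), 0 < W → ∀ (θ θ' θ'' : ℝ → ℝ),
    (∀ ω ∈ Ioo 0 W, HasDerivAt θ (θ' ω) ω ∧ HasDerivAt θ' (θ'' ω) ω) →
    (∀ ω ∈ Ioo 0 W, a / ω ≤ θ'' ω ∧ θ'' ω ≤ A / ω) →
    (∀ ω ∈ Ioo 0 W, θ' ω ≤ u₀) →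
    (∃ m : ℤ, Tendsto θ (𝓝[>] 0) (𝓝 (m * Real.pi / 2))) →
    ∀ c : ℝ → ℝ, Continuous c → HasCompactSupport c → Function.support c ⊆ Ioo 0 W →
      let Z : ℝ → ℂ := fun u => ∫ ω, (c ω : ℂ) * Complex.exp (Complex.I * ((θ ω : ℂ) - (ω : ℂ) * (u : ℂ)))
      c₀ * (2 * Real.pi * ∫ ω, c ω ^ 2) ≤
        (∫ u in Iic u₀, ‖Z u‖ ^ 2) - |(∫ u in Iic u₀, Z u ^ 2).re|

/-- The sanity anchor of the lemma (the flat odd-dimensional / half-integer case, Duyckaerts–Kenig–Merle):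
for a CONSTANT benign phase and `u₀ = 0` the caught fraction is exactly one half for both parities:
`A(0) = E/2` (the profile `|Z|` is even in `u` for real `c`) and `B(0) = 0`.  Stated as a Prop; it is the
`a → 0` boundary of the lemma's regime, provable with Mathlib's Fourier analysis today. [folklore in method] -/
def BenignConstantPhaseIdentity : Prop :=
  ∀ (m : ℤ) (c : ℝ → ℝ), Continuous c → HasCompactSupport c → Function.support c ⊆ Ioi 0 →
    let Z : ℝ → ℂ := fun u => ∫ ω, (c ω : ℂ) * Complex.exp (Complex.I * ((m * Real.pi / 2 : ℝ) - (ω : ℂ) * (u : ℂ)))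
    (∫ u in Iic (0 : ℝ), ‖Z u‖ ^ 2) = Real.pi * ∫ ω, c ω ^ 2 ∧ (∫ u in Iic (0 : ℝ), Z u ^ 2).re = 0

example : CoulombPhaseChannelLemma → True := fun _ => trivial

end Summit.FinalStateConjecture.FinalStateConjecture.Cruxes.WindowedShellChannels.CoulombPhase

end
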